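import Summits.AtomisticToContinuum.BoseEinsteinCondensation.Theorems.BECThomsonPrincipleGDTransferSeededGradingDefs
import Summits.AtomisticToContinuum.BoseEinsteinCondensation.Theorems.BECThomsonPrincipleGDTransferSeededPlainFormBridge
import Summits.AtomisticToContinuum.BoseEinsteinCondensation.Theorems.BECThomsonPrincipleGDTransferSeededPlainInteractionPairs

/-!
# Route `BECThomsonPrinciple`, crux `GDTransfer` (stmt-AtomisticToContinuum-9482), line `seeded-continuity`:
# stub `sharpCutSplitting` — the sharp-cut splitting inequality of the fixed-`N` seed programme

Registered stub `sharpCutSplitting : KineticBlockDiagonal → InteractionLocality → SectorBlockAlgebra →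
SharpCutSplitting` of the lead's fourth Defs file `…SeededGradingDefs` (line `seeded-continuity`).
Supports (does not close) stmt-AtomisticToContinuum-9482.

Cutting a periodic trial state `Ψ` at `n̂₀ = j` into the blocks `A = Ψ_{<j} = Σ_{|S|<j} Q_SΨ` and
`B = Ψ_{¬<j}` costs at most `C · P_Ψ(j−2 ≤ n̂₀ ≤ j+1)` in energy form when the interaction is bounded by `C`
on configuration space:

* polarisation along the line `Ψ = B + 1·A` (`PlainCost.eform_line_toReal`):
  `E(Ψ) = 𝓔(B) + 2(Re t(A,B) + Re 𝓥(A,B)) + 𝓔(A)` (all forms finite: `C¹` data, `V ≤ C`);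
* `t(A, B) = Σ_{S,T} t(Q_SΨ, Q_TΨ) = 0` termwise (`KineticBlockDiagonal`, `|S| < j ≤ |T|`);
* `𝓥(A, B) = Σ_{|S|<j≤|T|} 𝓥(Q_SΨ, Q_TΨ)`; by `InteractionLocality` the terms with `|T| ≥ |S| + 3` vanish
  (`|T ∖ S| ≥ |T| − |S|`), so only `S ∈ lo' = {j−2 ≤ |S| < j}`, `T ∈ hi' = {j ≤ |T| ≤ j+1}` survive and
  `𝓥(A, B) = 𝓥(A', B')` with `A' = Σ_{lo'} Q_SΨ`, `B' = Σ_{hi'} Q_TΨ`; pointwise `V|A'||B'| ≤ C(|A'|² + |B'|²)/2`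
  and Pythagoras (`Lnss.integral_norm_sq_sum_modeProj`) give `2|𝓥(A', B')| ≤ C Σ_{lo' ∪ hi'} ∫|Q_SΨ|² =
  C · P_Ψ(j−2 ≤ n̂₀ ≤ j+1)`;
* back to `ℝ≥0∞` (everything is finite).

All [folklore] (ReedSimonIV1978 §XIII.12, IMS-type localisation; LSSY2005 App. A).
-/

noncomputable section

open MeasureTheory Filter
open scoped ENNReal NNReal ComplexConjugate

namespace Summit.AtomisticToContinuum.BoseEinsteinCondensation.Cruxes.GDTransfer.Seeded

namespace SharpCut

open Literature.MathematicalPhysics.QuantumManyBody.BoseGas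
open Summit.AtomisticToContinuum.BoseEinsteinCondensation.Theorems.GaussianDominationCan.Negative (modeProj)
open Summit.AtomisticToContinuum.BoseEinsteinCondensation.Cruxes.GDTransfer.DysonDressedWitness
open ChordVariation (continuous_modeProj mass_ne_top_of_continuous)
open Lnss (contDiff_modeProj integral_norm_sq_sum_modeProj lintegral_nnnorm_sq_eq)

variable {m : ℕ} {L : ℝ} {v : ℝ → ℝ≥0∞}

/-! ## Finite sums in the kinetic and interaction forms -/

/-- `t(Σ_i F_i, g) = Σ_i t(F_i, g)` for `C¹` data. [folklore] -/
theorem tform_sum_left {ι : Type*} (s : Finset ι) {F : ι → Config (m + 1) → ℂ}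
    (hF : ∀ i ∈ s, ContDiff ℝ 1 (F i)) {g : Config (m + 1) → ℂ} (hg : ContDiff ℝ 1 g) :
    tform m L (∑ i ∈ s, F i) g = ∑ i ∈ s, tform m L (F i) g := by
  unfold tform
  rw [← integral_finsetSum s fun i hi => PlainCost.integrable_tIntegrand (hF i hi) hg]
  refine integral_congr_ae (Eventually.of_forall fun X => ?_)
  have hd : fderiv ℝ (∑ i ∈ s, F i) X = ∑ i ∈ s, fderiv ℝ (F i) X :=
    fderiv_sum fun i hi => ((hF i hi).differentiable one_ne_zero).differentiableAt
  dsimp only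
  rw [hd]
  simp only [sum_apply, map_sum, Finset.sum_mul]
  exact (Finset.sum_congr rfl fun j _ => Finset.sum_comm).trans Finset.sum_comm

/-- `t(f, Σ_i G_i) = Σ_i t(f, G_i)` for `C¹` data. [folklore] -/
theorem tform_sum_right {ι : Type*} (s : Finset ι) {f : Config (m + 1) → ℂ} (hf : ContDiff ℝ 1 f)
    {G : ι → Config (m + 1) → ℂ} (hG : ∀ i ∈ s, ContDiff ℝ 1 (G i)) :
    tform m L f (∑ i ∈ s, G i) = ∑ i ∈ s, tform m L f (G i) := by
  rw [PlainCost.tform_conj_symm, tform_sum_left s hG hf, map_sum]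
  exact Finset.sum_congr rfl fun i _ => (PlainCost.tform_conj_symm _ _).symm

/-- `𝓥(Σ_i F_i, g) = Σ_i 𝓥(F_i, g)` for continuous data and a continuous real interaction. [folklore] -/
theorem vform_sum_left {ι : Type*} (s : Finset ι)
    (hW : Continuous fun X : Config (m + 1) => (periodicInteraction v L X).toReal)
    {F : ι → Config (m + 1) → ℂ} (hF : ∀ i ∈ s, Continuous (F i)) {g : Config (m + 1) → ℂ}
    (hg : Continuous g) :
    vform v m L (∑ i ∈ s, F i) g = ∑ i ∈ s, vform v m L (F i) g := by
  unfold vform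
  simp only [Finset.sum_apply]
  exact PlainInteraction.form_sum_left s hW hF hg

/-- `𝓥(f, Σ_i G_i) = Σ_i 𝓥(f, G_i)` for continuous data and a continuous real interaction. [folklore] -/
theorem vform_sum_right {ι : Type*} (s : Finset ι)
    (hW : Continuous fun X : Config (m + 1) => (periodicInteraction v L X).toReal)
    {f : Config (m + 1) → ℂ} (hf : Continuous f) {G : ι → Config (m + 1) → ℂ}
    (hG : ∀ i ∈ s, Continuous (G i)) :
    vform v m L f (∑ i ∈ s, G i) = ∑ i ∈ s, vform v m L f (G i) := by
  unfold vform
  simp only [Finset.sum_apply]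
  exact PlainInteraction.form_sum_right s hW hf hG

/-- A finite sum of continuous functions on configuration space is continuous (unapplied form). [folklore] -/
theorem continuous_sum_fn {ι : Type*} (s : Finset ι) {F : ι → Config (m + 1) → ℂ}
    (hF : ∀ i ∈ s, Continuous (F i)) : Continuous (∑ i ∈ s, F i) := by
  rw [Finset.sum_fn]
  exact continuous_finsetSum s hF

/-- A finite sum of `C¹` functions on configuration space is `C¹` (unapplied form). [folklore] -/
theorem contDiff_sum_fn {ι : Type*} (s : Finset ι) {F : ι → Config (m + 1) → ℂ}
    (hF : ∀ i ∈ s, ContDiff ℝ 1 (F i)) : ContDiff ℝ 1 (∑ i ∈ s, F i) := by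
  rw [Finset.sum_fn]
  exact ContDiff.sum hF

/-! ## Finiteness and the pointwise bound of the interaction form -/

/-- The energy form of a `C¹` function is finite when the interaction is bounded on configuration space.
[folklore] -/
theorem eform_ne_top_of_bounded (v : ℝ → ℝ≥0∞) {C : ℝ≥0}
    (hC : ∀ X : Config (m + 1), periodicInteraction v L X ≤ C) {f : Config (m + 1) → ℂ}
    (hf : ContDiff ℝ 1 f) : eform v L f ≠ ⊤ := by
  have hW : ∫⁻ X in cellN (m + 1) L, periodicInteraction v L X * ((‖f X‖₊ : ℝ≥0∞)) ^ 2 ≤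
      (C : ℝ≥0∞) * mass L f :=
    calc ∫⁻ X in cellN (m + 1) L, periodicInteraction v L X * ((‖f X‖₊ : ℝ≥0∞)) ^ 2
        ≤ ∫⁻ X in cellN (m + 1) L, (C : ℝ≥0∞) * ((‖f X‖₊ : ℝ≥0∞)) ^ 2 :=
          lintegral_mono fun X => mul_le_mul_left (hC X) _
      _ = (C : ℝ≥0∞) * mass L f := lintegral_const_mul' _ _ ENNReal.coe_ne_top
  rw [Bare.eform_eq_add, lintegral_kineticDensity_eq hf]
  exact ENNReal.add_ne_top.2 ⟨ENNReal.ofReal_ne_top, ne_top_of_le_ne_top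
    (ENNReal.mul_ne_top ENNReal.coe_ne_top (mass_ne_top_of_continuous hf.continuous)) hW⟩

/-- **`|𝓥(f, g)| ≤ (C/2)(∫|f|² + ∫|g|²)`** for continuous `f, g` when the interaction is bounded by `C`
(pointwise `V|f||g| ≤ C(|f|² + |g|²)/2`). [folklore] -/
theorem norm_vform_le {C : ℝ≥0} (hC : ∀ X : Config (m + 1), periodicInteraction v L X ≤ C)
    {f g : Config (m + 1) → ℂ} (hf : Continuous f) (hg : Continuous g) :
    ‖vform v m L f g‖ ≤ (C : ℝ) / 2 *
      ((∫ X in cellN (m + 1) L, ‖f X‖ ^ 2) + ∫ X in cellN (m + 1) L, ‖g X‖ ^ 2) := by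
  unfold vform
  have hCX : ∀ X, (periodicInteraction v L X).toReal ≤ C := fun X => by
    have h := ENNReal.toReal_mono ENNReal.coe_ne_top (hC X)
    rwa [ENNReal.coe_toReal] at h
  have hf2 : Integrable (fun X => ‖f X‖ ^ 2)
      ((volume : Measure (Config (m + 1))).restrict (cellN (m + 1) L)) :=
    integrableOn_cellN (hf.norm.pow 2) L
  have hg2 : Integrable (fun X => ‖g X‖ ^ 2)
      ((volume : Measure (Config (m + 1))).restrict (cellN (m + 1) L)) :=
    integrableOn_cellN (hg.norm.pow 2) L
  have hint : Integrable (fun X => (C : ℝ) / 2 * (‖f X‖ ^ 2 + ‖g X‖ ^ 2))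
      ((volume : Measure (Config (m + 1))).restrict (cellN (m + 1) L)) :=
    (hf2.add hg2).const_mul _
  refine (norm_integral_le_of_norm_le hint (Eventually.of_forall fun X => ?_)).trans_eq ?_
  · rw [norm_mul, norm_mul, Complex.norm_real, Real.norm_of_nonneg ENNReal.toReal_nonneg,
      Complex.norm_conj]
    have h0 : 0 ≤ ‖f X‖ * ‖g X‖ := mul_nonneg (norm_nonneg _) (norm_nonneg _)
    have h1 : ‖f X‖ * ‖g X‖ ≤ (‖f X‖ ^ 2 + ‖g X‖ ^ 2) / 2 := by
      nlinarith [sq_nonneg (‖f X‖ - ‖g X‖)]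
    calc (periodicInteraction v L X).toReal * (‖f X‖ * ‖g X‖) ≤ C * (‖f X‖ * ‖g X‖) :=
          mul_le_mul_of_nonneg_right (hCX X) h0
      _ ≤ C * ((‖f X‖ ^ 2 + ‖g X‖ ^ 2) / 2) := mul_le_mul_of_nonneg_left h1 C.coe_nonneg
      _ = (C : ℝ) / 2 * (‖f X‖ ^ 2 + ‖g X‖ ^ 2) := by ring
  · rw [integral_const_mul, integral_add hf2 hg2]

/-! ## The law mass in real form; bookkeeping of the band -/

/-- `(P_ψ(n̂₀ ∈ p)).toReal = Σ_{|S| ∈ p} ∫|Q_Sψ|²` for continuous `ψ`. [folklore] -/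
theorem lawMass_toReal (p : ℕ → Prop) [DecidablePred p] {ψ : Config (m + 1) → ℂ} (hψ : Continuous ψ) :
    (lawMass m L p ψ).toReal =
      ∑ S ∈ (Finset.univ : Finset (Finset (Fin (m + 1)))).filter (fun S => p S.card),
        ∫ X in cellN (m + 1) L, ‖modeProj (m + 1) L S ψ X‖ ^ 2 := by
  unfold lawMass compMass
  have h : ∀ S : Finset (Fin (m + 1)),
      ∫⁻ X in cellN (m + 1) L, (‖modeProj (m + 1) L S ψ X‖₊ : ℝ≥0∞) ^ 2 =
        ENNReal.ofReal (∫ X in cellN (m + 1) L, ‖modeProj (m + 1) L S ψ X‖ ^ 2) := fun S =>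
    lintegral_nnnorm_sq_eq _ (continuous_modeProj S hψ)
  simp only [h]
  rw [ENNReal.toReal_sum fun S _ => ENNReal.ofReal_ne_top]
  exact Finset.sum_congr rfl fun S _ => ENNReal.toReal_ofReal (integral_nonneg fun X => sq_nonneg _)

/-- The law mass of a continuous function is finite. [folklore] -/
theorem lawMass_ne_top' (p : ℕ → Prop) [DecidablePred p] {ψ : Config (m + 1) → ℂ} (hψ : Continuous ψ) :
    lawMass m L p ψ ≠ ⊤ := by
  unfold lawMass compMass
  refine ENNReal.sum_ne_top.2 fun S _ => ?_
  rw [lintegral_nnnorm_sq_eq _ (continuous_modeProj S hψ)]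
  exact ENNReal.ofReal_ne_top

/-- **Band bookkeeping**: if the `(S, T)` entries vanish whenever `|T| ≥ |S| + 3`, the double sum over
`|S| < j ≤ |T|` equals the double sum over `j − 2 ≤ |S| < j`, `j ≤ |T| ≤ j + 1`. [folklore] -/
theorem sum_cut_eq_sum_band {α : Type*} [AddCommMonoid α] {ι : Type*} (U : Finset ι) (c : ι → ℕ)
    (V : ι → ι → α) (j : ℕ) (hfar : ∀ S T, c S + 3 ≤ c T → V S T = 0) :
    ∑ S ∈ U.filter (fun S => c S < j), ∑ T ∈ U.filter (fun T => ¬ c T < j), V S T =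
      ∑ S ∈ U.filter (fun S => j ≤ c S + 2 ∧ c S < j),
        ∑ T ∈ U.filter (fun T => j ≤ c T ∧ c T ≤ j + 1), V S T := by
  symm
  calc ∑ S ∈ U.filter (fun S => j ≤ c S + 2 ∧ c S < j),
        ∑ T ∈ U.filter (fun T => j ≤ c T ∧ c T ≤ j + 1), V S T
      = ∑ S ∈ U.filter (fun S => j ≤ c S + 2 ∧ c S < j), ∑ T ∈ U.filter (fun T => ¬ c T < j), V S T := by
        refine Finset.sum_congr rfl fun S hS => Finset.sum_subset (fun T hT => ?_) fun T hT hT' => ?_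
        · simp only [Finset.mem_filter] at hT ⊢
          exact ⟨hT.1, not_lt.2 hT.2.1⟩
        · simp only [Finset.mem_filter, not_and, not_le] at hS hT hT'
          exact hfar S T (by have := hT' hT.1; omega)
    _ = ∑ S ∈ U.filter (fun S => c S < j), ∑ T ∈ U.filter (fun T => ¬ c T < j), V S T := by
        refine Finset.sum_subset (fun S hS => ?_) fun S hS hS' => Finset.sum_eq_zero fun T hT => ?_
        · simp only [Finset.mem_filter] at hS ⊢
          exact ⟨hS.1, hS.2.2⟩
        · simp only [Finset.mem_filter, not_and, not_lt] at hS hS' hT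
          exact hfar S T (by have := hS' hS.1; omega)

/-- The band `j − 2 ≤ |S| ≤ j + 1` is the disjoint union of its lower half `|S| < j` and its upper half
`j ≤ |S|`. [folklore] -/
theorem sum_band_split {α : Type*} [AddCommMonoid α] {ι : Type*} (U : Finset ι) (c : ι → ℕ)
    (w : ι → α) (j : ℕ) :
    ∑ S ∈ U.filter (fun S => j ≤ c S + 2 ∧ c S ≤ j + 1), w S =
      ∑ S ∈ U.filter (fun S => j ≤ c S + 2 ∧ c S < j), w S +
        ∑ S ∈ U.filter (fun S => j ≤ c S ∧ c S ≤ j + 1), w S := by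
  rw [← Finset.sum_filter_add_sum_filter_not (U.filter fun S => j ≤ c S + 2 ∧ c S ≤ j + 1)
    (fun S => c S < j), Finset.filter_filter, Finset.filter_filter]
  congr 1
  · refine Finset.sum_congr (Finset.filter_congr fun S _ => ?_) fun _ _ => rfl
    omega
  · refine Finset.sum_congr (Finset.filter_congr fun S _ => ?_) fun _ _ => rfl
    omega

/-! ## The two cross terms across the cut -/

/-- **The kinetic cross term across the cut vanishes**: `t(Ψ_{<j}, Ψ_{¬<j}) = 0` (block diagonality,
`|S| < j ≤ |T|` forces `S ≠ T`). [folklore] -/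
theorem tform_cut_eq_zero (hK : KineticBlockDiagonal) (hL : 0 < L) (Ψ : PeriodicTrialState (m + 1) L)
    (j : ℕ) :
    tform m L (sectorBlock m L (fun i => i < j) Ψ.ψ) (sectorBlock m L (fun i => ¬ i < j) Ψ.ψ) = 0 := by
  have hQ : ∀ S : Finset (Fin (m + 1)), ContDiff ℝ 1 (modeProj (m + 1) L S Ψ.ψ) := fun S =>
    contDiff_modeProj S Ψ.contDiff
  unfold sectorBlock
  rw [tform_sum_left _ (fun S _ => hQ S) (contDiff_sum_fn _ fun T _ => hQ T)]
  refine Finset.sum_eq_zero fun S hS => ?_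
  rw [tform_sum_right _ (hQ S) fun T _ => hQ T]
  refine Finset.sum_eq_zero fun T hT => hK m L hL S T (fun hST => ?_) Ψ.ψ Ψ.contDiff
  simp only [Finset.mem_filter] at hS hT
  exact hT.2 (hST ▸ hS.2)

/-- **The interaction cross term across the cut lives in the band**:
`|𝓥(Ψ_{<j}, Ψ_{¬<j})| ≤ (C/2) · P_Ψ(j−2 ≤ n̂₀ ≤ j+1).toReal` (bandwidth two, `V ≤ C`, Pythagoras).
[folklore] -/
theorem norm_vform_cut_le (hV : InteractionLocality) (hv : IsRepulsiveFiniteRange v)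
    (hfc : IsFiniteContinuous v) (hL : 0 < L) {C : ℝ≥0}
    (hC : ∀ X : Config (m + 1), periodicInteraction v L X ≤ C) (Ψ : PeriodicTrialState (m + 1) L)
    (j : ℕ) :
    ‖vform v m L (sectorBlock m L (fun i => i < j) Ψ.ψ) (sectorBlock m L (fun i => ¬ i < j) Ψ.ψ)‖ ≤
      (C : ℝ) / 2 * (lawMass m L (fun i => j ≤ i + 2 ∧ i ≤ j + 1) Ψ.ψ).toReal := by
  have hW :=
    PlainInteraction.continuous_toReal_periodicInteraction (N := m + 1) (L := L) hv hfc hL.ne'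
  have hψc : Continuous Ψ.ψ := Ψ.contDiff.continuous
  have hQ : ∀ S : Finset (Fin (m + 1)), Continuous (modeProj (m + 1) L S Ψ.ψ) := fun S =>
    continuous_modeProj S hψc
  -- bandwidth two: the far entries vanish
  have hfar : ∀ S T : Finset (Fin (m + 1)), S.card + 3 ≤ T.card →
      vform v m L (modeProj (m + 1) L S Ψ.ψ) (modeProj (m + 1) L T Ψ.ψ) = 0 := fun S T hST =>
    hV v hv hfc m L hL S T (by have := Finset.le_card_sdiff S T; omega) Ψ.ψ hψc
  -- expand both blocks, drop the far entries, re-sum over the band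
  have key :
      vform v m L (sectorBlock m L (fun i => i < j) Ψ.ψ) (sectorBlock m L (fun i => ¬ i < j) Ψ.ψ) =
      vform v m L
        (∑ S ∈ (Finset.univ : Finset (Finset (Fin (m + 1)))).filter
            (fun S => j ≤ S.card + 2 ∧ S.card < j), modeProj (m + 1) L S Ψ.ψ)
        (∑ T ∈ (Finset.univ : Finset (Finset (Fin (m + 1)))).filter
            (fun T => j ≤ T.card ∧ T.card ≤ j + 1), modeProj (m + 1) L T Ψ.ψ) := by
    unfold sectorBlock
    rw [vform_sum_left _ hW (fun S _ => hQ S) (continuous_sum_fn _ fun T _ => hQ T),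
      vform_sum_left _ hW (fun S _ => hQ S) (continuous_sum_fn _ fun T _ => hQ T)]
    simp only [vform_sum_right _ hW (hQ _) fun T _ => hQ T]
    exact sum_cut_eq_sum_band _ Finset.card _ j hfar
  rw [key]
  refine (norm_vform_le hC (continuous_sum_fn _ fun S _ => hQ S)
    (continuous_sum_fn _ fun T _ => hQ T)).trans (le_of_eq ?_)
  -- Pythagoras in each half of the band
  have pyth : ∀ 𝒯 : Finset (Finset (Fin (m + 1))),
      ∫ X in cellN (m + 1) L, ‖(∑ S ∈ 𝒯, modeProj (m + 1) L S Ψ.ψ) X‖ ^ 2 =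
        ∑ S ∈ 𝒯, ∫ X in cellN (m + 1) L, ‖modeProj (m + 1) L S Ψ.ψ X‖ ^ 2 := fun 𝒯 => by
    have h := integral_norm_sq_sum_modeProj hL 𝒯 (fun _ => (1 : ℂ)) hψc
    simp only [one_mul, norm_one, one_pow] at h
    simp only [Finset.sum_apply]
    exact h
  rw [pyth, pyth, lawMass_toReal _ hψc, sum_band_split _ Finset.card _ j]

end SharpCut

open Literature.MathematicalPhysics.QuantumManyBody.BoseGas in
open Summit.AtomisticToContinuum.BoseEinsteinCondensation.Cruxes.GDTransfer.DysonDressedWitness in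
/-- **The sharp-cut splitting inequality** (registered stub `sharpCutSplitting` of the fixed-`N` seed programme):
for a finite continuous profile whose periodic interaction is bounded by `C` on configuration space, cutting a
periodic trial state at `n̂₀ = j` costs at most `C` times the mass of the four sectors around the cut,
`𝓔(Ψ_{<j}) + 𝓔(Ψ_{¬<j}) ≤ E(Ψ) + C · P_Ψ(j−2 ≤ n̂₀ ≤ j+1)` — given block diagonality of the kinetic form,
bandwidth two of the interaction form and the algebra of sector blocks. [folklore] -/
theorem sharpCutSplitting : KineticBlockDiagonal → InteractionLocality → SectorBlockAlgebra → SharpCutSplitting := by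
  intro hK hV hA v hv hfc m L hL C hC Ψ j
  set A := sectorBlock m L (fun i => i < j) Ψ.ψ
  set B := sectorBlock m L (fun i => ¬ i < j) Ψ.ψ
  obtain ⟨hAdir, -, hres, -⟩ := hA m L hL (fun i => i < j) Ψ
  have hA1 : ContDiff ℝ 1 A := hAdir.contDiff
  have hB1 : ContDiff ℝ 1 B := (hA m L hL (fun i => ¬ i < j) Ψ).1.contDiff
  have hAfin : eform v L A ≠ ⊤ := SharpCut.eform_ne_top_of_bounded v hC hA1
  have hBfin : eform v L B ≠ ⊤ := SharpCut.eform_ne_top_of_bounded v hC hB1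
  have hEfin : periodicEnergy v Ψ ≠ ⊤ := SharpCut.eform_ne_top_of_bounded v hC Ψ.contDiff
  have hMfin : lawMass m L (fun i => j ≤ i + 2 ∧ i ≤ j + 1) Ψ.ψ ≠ ⊤ :=
    SharpCut.lawMass_ne_top' _ Ψ.contDiff.continuous
  -- the state along the line `B + 1·A`
  have hline : Ψ.ψ = fun X => B X + ((1 : ℝ) : ℂ) * A X := by
    funext X
    rw [← hres X, Complex.ofReal_one, one_mul, add_comm]
  have hexp := PlainCost.eform_line_toReal (L := L) hv.1 hA1 hB1 hAfin hBfin 1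
  have ht : tform m L A B = 0 := SharpCut.tform_cut_eq_zero hK hL Ψ j
  rw [← hline, eform_trialState, ht, Complex.zero_re, zero_add, one_pow, one_mul, mul_one] at hexp
  have hcross : ‖vform v m L A B‖ ≤
      (C : ℝ) / 2 * (lawMass m L (fun i => j ≤ i + 2 ∧ i ≤ j + 1) Ψ.ψ).toReal :=
    SharpCut.norm_vform_cut_le hV hv hfc hL hC Ψ j
  have hre : |(vform v m L A B).re| ≤ ‖vform v m L A B‖ := Complex.abs_re_le_norm (vform v m L A B)
  -- back to `ℝ≥0∞`
  rw [← ENNReal.toReal_le_toReal (ENNReal.add_ne_top.2 ⟨hAfin, hBfin⟩)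
    (ENNReal.add_ne_top.2 ⟨hEfin, ENNReal.mul_ne_top ENNReal.coe_ne_top hMfin⟩),
    ENNReal.toReal_add hAfin hBfin,
    ENNReal.toReal_add hEfin (ENNReal.mul_ne_top ENNReal.coe_ne_top hMfin), ENNReal.toReal_mul,
    ENNReal.coe_toReal]
  rw [abs_le] at hre
  linarith [hre.1, hre.2, hcross, hexp]

end Summit.AtomisticToContinuum.BoseEinsteinCondensation.Cruxes.GDTransfer.Seeded

end
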